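import Summits.ValiantsHypothesis.ValiantsHypothesis.Theorems.SymPencilSingSixClassificationZeroLine
import Summits.ValiantsHypothesis.ValiantsHypothesis.Theorems.SymPencilPerFourJointFamilyTransport
import Summits.ValiantsHypothesis.ValiantsHypothesis.Theorems.SymPencilPerFourCrossKronecker
import Summits.ValiantsHypothesis.ValiantsHypothesis.Theorems.SymPencilPerFourPairingHyperplane
import Summits.ValiantsHypothesis.ValiantsHypothesis.Theorems.SymPencilPerFourLowRankSeven
import Summits.ValiantsHypothesis.ValiantsHypothesis.Theorems.SymPencilPerFourTwoRowCorankTwo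

/-!
# Route `SymPencil` — the V-side of the size-27 cell `(11, 5, 4)`, PORT of val-idea-18's cascade, leaf X (part 1: arms)
# (`--supports` stmt-ValiantsHypothesis-5674 `SdcSuperquadratic`; verbatim port of §2a of
# `Cruxes/SdcSuperquadratic/Lines/sing_five_classification.lean` rev 10 (val-idea-18 g5), toward a Theorems-level
# `noJointFamily_five_four` (PORT-PLAN-115.md, evidence #60 on 5674); rung currency only)

Leaf X of the cascade: a `5`-dimensional `W` inside a cross `X_{lc}` carrying a per-direction family of `≤ 4` squares at
every element is `X_{lc} ∩ {x_(l,a) = 0} ∩ {x_(b,c) = 0}`.  This part: `exists_span_of_support` (coordinate spans) and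
`colArm_eq_zero_of_sum_sq_four` (the Kronecker form of ✓ `SymPencilPerFourCrossKronecker` under four squares forces an arm
coordinate to vanish at a cross element).  Continuation: `SymPencilSingFiveLeafCross`.

Honest framing: [folklore] linear algebra, a port; the cell `(11, 5, 4)` is closed at the workfile level and modulo `hV` at the
Theorems level (✓ `SymPencilSdcPerFourCellElevenFive`); `27 ≤ sdc(per₄) ≤ 29` unchanged; the crux `SdcSuperquadratic` and
`VP ≠ VNP` untouched; no summit statement is proved here.  No definitions, no named facts.
-/

noncomputable section

-- single-conjunct layout: Sub = Summit, duplicated namespace component intended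
set_option linter.dupNamespace false

namespace Summit.ValiantsHypothesis.ValiantsHypothesis.Theorems.SymPencilSingFiveClassification

open MvPolynomial Module Matrix
open scoped Polynomial
open Literature.Computability.AlgebraicComplexity
open Summit.ValiantsHypothesis.ValiantsHypothesis.Theorems
open Summit.ValiantsHypothesis.ValiantsHypothesis.Theorems.SymPencilSingSixClassification
open Summit.ValiantsHypothesis.ValiantsHypothesis.Theorems.SymPencilPerFourJointFamilyTransport

variable {K : Type*} [Field K]

/-- Coordinate span: vectors vanishing off a finite set `T` of cells lie in a submodule of
dimension `≤ |T|` (cf. `SymPencilPerFourCrossFilter.exists_crossSpan_erase`). [folklore] -/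
theorem exists_span_of_support (T : Finset (Fin 4 × Fin 4)) :
    ∃ C : Submodule K (Fin 4 × Fin 4 → K), finrank K C ≤ T.card ∧
      ∀ z : Fin 4 × Fin 4 → K, (∀ p, p ∉ T → z p = 0) → z ∈ C := by
  classical
  refine ⟨Submodule.span K ↑(T.image fun p => (Pi.single p (1 : K) : Fin 4 × Fin 4 → K)),
    (finrank_span_finset_le_card _).trans Finset.card_image_le, ?_⟩
  intro z hz0
  have hdecomp : z = ∑ p ∈ T, z p • (Pi.single p (1 : K) : Fin 4 × Fin 4 → K) :=
    calc z = ∑ p, (Pi.single p (z p) : Fin 4 × Fin 4 → K) := (Finset.univ_sum_single z).symm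
      _ = ∑ p ∈ T, (Pi.single p (z p) : Fin 4 × Fin 4 → K) := by
        symm
        refine Finset.sum_subset (Finset.subset_univ T) fun p _ hp => ?_
        rw [hz0 p hp, Pi.single_zero]
      _ = ∑ p ∈ T, z p • (Pi.single p (1 : K) : Fin 4 × Fin 4 → K) :=
        Finset.sum_congr rfl fun p _ => by
          ext p'
          by_cases hp : p' = p
          · subst hp; simp
          · simp [hp]
  rw [hdecomp]
  exact Submodule.sum_mem _ fun p hp => Submodule.smul_mem _ _
    (Submodule.subset_span (Finset.mem_coe.2 (Finset.mem_image_of_mem _ hp)))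

/-- **Kronecker form with four squares** (pointwise core of leaf X, memo §3): for `y ∈ X₃₃` with a
per-direction family of `≤ 4` squares, a row arm with non-zero product forces … (memo). [folklore] -/
theorem colArm_eq_zero_of_sum_sq_four [CharZero K] (y : Fin 4 × Fin 4 → K)
    (hy : ∀ i j : Fin 4, i ≠ 3 → j ≠ 3 → y (i, j) = 0) (c : Fin 4 → K)
    (Λ : Fin 4 → ((Fin 4 × Fin 4 → K) →ₗ[K] K))
    (hfam : ∀ u : Fin 4 × Fin 4 → K, ∃ e₀ e₁ : K, ∀ s : K,
      eval (u + s • y) (perPoly (Fin 4) K) = e₀ + s * e₁ + s ^ 2 * ∑ k, c k * (Λ k u) ^ 2)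
    (ha : y (3, 0) * y (3, 1) * y (3, 2) ≠ 0) :
    y (0, 3) = 0 ∧ y (1, 3) = 0 ∧ y (2, 3) = 0 := by
  classical
  have ha' : y (3, 2) * y (3, 1) * y (3, 0) ≠ 0 := by
    intro h; apply ha; linear_combination h
  obtain ⟨f01, f02, f10, f12, f20, f21⟩ :
      (((0 : Fin 3) = 1) = False) ∧ (((0 : Fin 3) = 2) = False) ∧
      (((1 : Fin 3) = 0) = False) ∧ (((1 : Fin 3) = 2) = False) ∧
      (((2 : Fin 3) = 0) = False) ∧ (((2 : Fin 3) = 1) = False) := by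
    refine ⟨?_, ?_, ?_, ?_, ?_, ?_⟩ <;> decide
  obtain ⟨U, hU⟩ := SymPencilPerFourCrossKronecker.exists_blockEmbedding (K := K)
  obtain ⟨Q, hQ⟩ : ∃ Q : (Fin 3 × Fin 3 → K) → K, ∀ w, Q w =
      y (0, 3) * y (3, 0) * (w (1, 1) * w (2, 2) + w (1, 2) * w (2, 1)) +
        y (0, 3) * y (3, 1) * (w (1, 0) * w (2, 2) + w (1, 2) * w (2, 0)) +
        y (0, 3) * y (3, 2) * (w (1, 0) * w (2, 1) + w (1, 1) * w (2, 0)) +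
        y (1, 3) * y (3, 0) * (w (0, 1) * w (2, 2) + w (0, 2) * w (2, 1)) +
        y (1, 3) * y (3, 1) * (w (0, 0) * w (2, 2) + w (0, 2) * w (2, 0)) +
        y (1, 3) * y (3, 2) * (w (0, 0) * w (2, 1) + w (0, 1) * w (2, 0)) +
        y (2, 3) * y (3, 0) * (w (0, 1) * w (1, 2) + w (0, 2) * w (1, 1)) +
        y (2, 3) * y (3, 1) * (w (0, 0) * w (1, 2) + w (0, 2) * w (1, 0)) +
        y (2, 3) * y (3, 2) * (w (0, 0) * w (1, 1) + w (0, 1) * w (1, 0)) := ⟨_, fun _ => rfl⟩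
  have hB : ∀ w : Fin 3 × Fin 3 → K, ∑ k, c k * (Λ k (U w)) ^ 2 = Q w := by
    intro w
    obtain ⟨e₀, e₁, he⟩ := hfam (U w)
    have hA := SymPencilPerFourCrossKronecker.eval_cross_block y hy U hU w
    rw [hQ]
    exact SymPencilPerFourCrossPairNoJoint.coeff_two_eq_of_forall₂ (fun s => (he s).symm.trans (hA s))
  let M : (Fin 3 × Fin 3 → K) →ₗ[K] (Fin 4 → K) := LinearMap.pi fun k => (Λ k).comp U
  have hM : ∀ n k, M n k = Λ k (U n) := fun n k => rfl
  have hker5 : 5 ≤ finrank K (LinearMap.ker M) := by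
    have h := LinearMap.finrank_range_add_finrank_ker M
    have hr : finrank K (LinearMap.range M) ≤ 4 :=
      calc finrank K (LinearMap.range M) ≤ finrank K (Fin 4 → K) := Submodule.finrank_le _
        _ = 4 := by rw [Module.finrank_fintype_fun_eq_card, Fintype.card_fin]
    rw [Module.finrank_fintype_fun_eq_card, Fintype.card_prod, Fintype.card_fin] at h
    omega
  obtain ⟨E, hE⟩ : ∃ E : Fin 3 × Fin 3 → (Fin 3 × Fin 3 → K), ∀ P p, E P p = if p = P then 1 else 0 :=
    ⟨fun P p => if p = P then 1 else 0, fun _ _ => rfl⟩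
  have key : ∀ n ∈ LinearMap.ker M,
      (y (2, 3) * n (1, 0) + y (1, 3) * n (2, 0) = 0 ∧ y (2, 3) * n (1, 1) + y (1, 3) * n (2, 1) = 0 ∧
        y (2, 3) * n (1, 2) + y (1, 3) * n (2, 2) = 0) ∧
      (y (2, 3) * n (0, 0) + y (0, 3) * n (2, 0) = 0 ∧ y (2, 3) * n (0, 1) + y (0, 3) * n (2, 1) = 0 ∧
        y (2, 3) * n (0, 2) + y (0, 3) * n (2, 2) = 0) ∧
      (y (1, 3) * n (0, 0) + y (0, 3) * n (1, 0) = 0 ∧ y (1, 3) * n (0, 1) + y (0, 3) * n (1, 1) = 0 ∧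
        y (1, 3) * n (0, 2) + y (0, 3) * n (1, 2) = 0) := by
    intro n hn
    have hΛ0 : ∀ k, Λ k (U n) = 0 := fun k => by
      have := congr_fun (LinearMap.mem_ker.1 hn) k
      rwa [hM] at this
    have hQn : Q n = 0 := by
      rw [← hB n]
      exact Finset.sum_eq_zero fun k _ => by rw [hΛ0 k]; ring
    have hQadd : ∀ e : Fin 3 × Fin 3 → K, Q (n + e) = Q e := by
      intro e
      rw [← hB (n + e), ← hB e]
      exact Finset.sum_congr rfl fun k _ => by rw [map_add, map_add, hΛ0 k, zero_add]
    have r00 := hQadd (E (0, 0))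
    have r01 := hQadd (E (0, 1))
    have r02 := hQadd (E (0, 2))
    have r10 := hQadd (E (1, 0))
    have r11 := hQadd (E (1, 1))
    have r12 := hQadd (E (1, 2))
    have r20 := hQadd (E (2, 0))
    have r21 := hQadd (E (2, 1))
    have r22 := hQadd (E (2, 2))
    simp only [hQ, hE, Pi.add_apply, Prod.mk.injEq, f01, f02, f10, f12, f20, f21, and_true,
      and_false, if_true, if_false] at r00 r01 r02 r10 r11 r12 r20 r21 r22 hQn
    refine ⟨?_, ?_, ?_⟩
    · exact SymPencilPerFourHessianMinors.eq_zero_of_pairing₃ ha'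
        (z₀ := y (2, 3) * n (1, 0) + y (1, 3) * n (2, 0))
        (z₁ := y (2, 3) * n (1, 1) + y (1, 3) * n (2, 1))
        (z₂ := y (2, 3) * n (1, 2) + y (1, 3) * n (2, 2))
        (by linear_combination r00 - hQn) (by linear_combination r01 - hQn)
        (by linear_combination r02 - hQn)
    · exact SymPencilPerFourHessianMinors.eq_zero_of_pairing₃ ha'
        (z₀ := y (2, 3) * n (0, 0) + y (0, 3) * n (2, 0))
        (z₁ := y (2, 3) * n (0, 1) + y (0, 3) * n (2, 1))
        (z₂ := y (2, 3) * n (0, 2) + y (0, 3) * n (2, 2))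
        (by linear_combination r10 - hQn) (by linear_combination r11 - hQn)
        (by linear_combination r12 - hQn)
    · exact SymPencilPerFourHessianMinors.eq_zero_of_pairing₃ ha'
        (z₀ := y (1, 3) * n (0, 0) + y (0, 3) * n (1, 0))
        (z₁ := y (1, 3) * n (0, 1) + y (0, 3) * n (1, 1))
        (z₂ := y (1, 3) * n (0, 2) + y (0, 3) * n (1, 2))
        (by linear_combination r20 - hQn) (by linear_combination r21 - hQn)
        (by linear_combination r22 - hQn)
  have hproj : ∀ i : Fin 3, (∀ n ∈ LinearMap.ker M, (∀ j, n (i, j) = 0) → n = 0) →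
      finrank K (LinearMap.ker M) ≤ 3 := by
    intro i hi
    let ρ : (Fin 3 × Fin 3 → K) →ₗ[K] (Fin 3 → K) := LinearMap.funLeft K K fun j => (i, j)
    have hρ : ∀ n j, ρ n j = n (i, j) := fun _ _ => rfl
    have hinj : Function.Injective (ρ.domRestrict (LinearMap.ker M)) := by
      intro n n' h
      apply Subtype.ext
      have h2 : ρ (n : Fin 3 × Fin 3 → K) = ρ n' := by
        simpa only [LinearMap.domRestrict_apply] using h
      have h3 := hi ((n : Fin 3 × Fin 3 → K) - n') (Submodule.sub_mem _ n.2 n'.2) fun j => by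
        have := congr_fun h2 j
        rw [hρ, hρ] at this
        rw [Pi.sub_apply, this, sub_self]
      exact sub_eq_zero.mp h3
    calc finrank K (LinearMap.ker M) ≤ finrank K (Fin 3 → K) :=
        LinearMap.finrank_le_finrank_of_injective hinj
      _ = 3 := by rw [Module.finrank_fintype_fun_eq_card, Fintype.card_fin]
  by_contra hb
  have hcases : y (0, 3) ≠ 0 ∨ y (1, 3) ≠ 0 ∨ y (2, 3) ≠ 0 := by
    by_contra h
    push Not at h
    exact hb ⟨h.1, h.2.1, h.2.2⟩
  have h3 : finrank K (LinearMap.ker M) ≤ 3 := by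
    rcases hcases with h0 | h1 | h2
    · -- `b₀ ≠ 0`: rows `1, 2` are determined by row `0`
      refine hproj 0 fun n hn hz => ?_
      obtain ⟨⟨-, -, -⟩, ⟨m10, m11, m12⟩, ⟨m20, m21, m22⟩⟩ := key n hn
      have z0 := hz 0
      have z1 := hz 1
      have z2 := hz 2
      have e20 : y (0, 3) * n (2, 0) = 0 := by linear_combination m10 - y (2, 3) * z0
      have e21 : y (0, 3) * n (2, 1) = 0 := by linear_combination m11 - y (2, 3) * z1
      have e22 : y (0, 3) * n (2, 2) = 0 := by linear_combination m12 - y (2, 3) * z2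
      have e10 : y (0, 3) * n (1, 0) = 0 := by linear_combination m20 - y (1, 3) * z0
      have e11 : y (0, 3) * n (1, 1) = 0 := by linear_combination m21 - y (1, 3) * z1
      have e12 : y (0, 3) * n (1, 2) = 0 := by linear_combination m22 - y (1, 3) * z2
      have n20 := (mul_eq_zero.1 e20).resolve_left h0
      have n21 := (mul_eq_zero.1 e21).resolve_left h0
      have n22 := (mul_eq_zero.1 e22).resolve_left h0
      have n10 := (mul_eq_zero.1 e10).resolve_left h0
      have n11 := (mul_eq_zero.1 e11).resolve_left h0
      have n12 := (mul_eq_zero.1 e12).resolve_left h0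
      funext p
      obtain ⟨i, j⟩ := p
      fin_cases i <;> fin_cases j
      · exact z0
      · exact z1
      · exact z2
      · exact n10
      · exact n11
      · exact n12
      · exact n20
      · exact n21
      · exact n22
    · -- `b₁ ≠ 0`: rows `0, 2` are determined by row `1`
      refine hproj 1 fun n hn hz => ?_
      obtain ⟨⟨m00, m01, m02⟩, ⟨-, -, -⟩, ⟨m20, m21, m22⟩⟩ := key n hn
      have z0 := hz 0
      have z1 := hz 1
      have z2 := hz 2
      have e20 : y (1, 3) * n (2, 0) = 0 := by linear_combination m00 - y (2, 3) * z0
      have e21 : y (1, 3) * n (2, 1) = 0 := by linear_combination m01 - y (2, 3) * z1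
      have e22 : y (1, 3) * n (2, 2) = 0 := by linear_combination m02 - y (2, 3) * z2
      have e00 : y (1, 3) * n (0, 0) = 0 := by linear_combination m20 - y (0, 3) * z0
      have e01 : y (1, 3) * n (0, 1) = 0 := by linear_combination m21 - y (0, 3) * z1
      have e02 : y (1, 3) * n (0, 2) = 0 := by linear_combination m22 - y (0, 3) * z2
      have n20 := (mul_eq_zero.1 e20).resolve_left h1
      have n21 := (mul_eq_zero.1 e21).resolve_left h1
      have n22 := (mul_eq_zero.1 e22).resolve_left h1
      have n00 := (mul_eq_zero.1 e00).resolve_left h1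
      have n01 := (mul_eq_zero.1 e01).resolve_left h1
      have n02 := (mul_eq_zero.1 e02).resolve_left h1
      funext p
      obtain ⟨i, j⟩ := p
      fin_cases i <;> fin_cases j
      · exact n00
      · exact n01
      · exact n02
      · exact z0
      · exact z1
      · exact z2
      · exact n20
      · exact n21
      · exact n22
    · -- `b₂ ≠ 0`: rows `0, 1` are determined by row `2`
      refine hproj 2 fun n hn hz => ?_
      obtain ⟨⟨m00, m01, m02⟩, ⟨m10, m11, m12⟩, ⟨-, -, -⟩⟩ := key n hn
      have z0 := hz 0
      have z1 := hz 1
      have z2 := hz 2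
      have e10 : y (2, 3) * n (1, 0) = 0 := by linear_combination m00 - y (1, 3) * z0
      have e11 : y (2, 3) * n (1, 1) = 0 := by linear_combination m01 - y (1, 3) * z1
      have e12 : y (2, 3) * n (1, 2) = 0 := by linear_combination m02 - y (1, 3) * z2
      have e00 : y (2, 3) * n (0, 0) = 0 := by linear_combination m10 - y (0, 3) * z0
      have e01 : y (2, 3) * n (0, 1) = 0 := by linear_combination m11 - y (0, 3) * z1
      have e02 : y (2, 3) * n (0, 2) = 0 := by linear_combination m12 - y (0, 3) * z2
      have n10 := (mul_eq_zero.1 e10).resolve_left h2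
      have n11 := (mul_eq_zero.1 e11).resolve_left h2
      have n12 := (mul_eq_zero.1 e12).resolve_left h2
      have n00 := (mul_eq_zero.1 e00).resolve_left h2
      have n01 := (mul_eq_zero.1 e01).resolve_left h2
      have n02 := (mul_eq_zero.1 e02).resolve_left h2
      funext p
      obtain ⟨i, j⟩ := p
      fin_cases i <;> fin_cases j
      · exact n00
      · exact n01
      · exact n02
      · exact n10
      · exact n11
      · exact n12
      · exact z0
      · exact z1
      · exact z2
  omega

end Summit.ValiantsHypothesis.ValiantsHypothesis.Theorems.SymPencilSingFiveClassification
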